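import Summits.BirchSwinnertonDyer.Rank1Residual.Additive.RamifiedSevenIntegralComparisonOfInputsR
import Summits.BirchSwinnertonDyer.Rank1Residual.Additive.RamifiedSevenGenusKSideRank
import Summits.BirchSwinnertonDyer.Rank1Residual.Additive.RamifiedSevenGenusHeckeTwistDictionary
import Summits.BirchSwinnertonDyer.Rank1Residual.Additive.RamifiedSevenGenusLayerCharacters
import Literature.NumberTheory.DiophantineGeometry.Conductor
import HarnessLib

set_option linter.dupNamespace false
set_option autoImplicit false

/-!
# `𝒞₇` genus road (crux `EllipticUnitValueSevenOfGZK`, K7r), row K2C-10 (B1): the FACTS JUNCTION composed with the (C6-R) ports —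
# `IntegralComparisonShape Φ` at a pinned frame from {datum `D : KatoExpDatum hγ Φ`, gauge, (KI) or the period-position inequality}
# + NAMED PRINT FACTS, and zp v12's `stub_integralComparisonSeven` letter from the REDUCED input forms — THEOREMS ONLY; nothing asserted

Seat bsd-idea-20 g74 (D-0154 ideator, crux-level, claim-free, kit 0; W-79 publish-only crux workfile — NOT a proposal, NOT a line,
never `skeleton check`ed), row K2C-10 of pen bsd-cm-plan g37 (D1013 / D1018 (A) / D1019), booking (B1) of
`Cruxes/EllipticUnitValueSevenOfGZK/K2C10RowClosure-g74.md` §4: «K2C-10 := facts junction LANDED + the corollary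
`integralComparisonShape_of_facts` over `KatoExpDatum` AFTER (KI)-R 4/4».  (KI)-R 4/4 = `Additive/RamifiedSevenIntegralComparisonOfInputsR.lean`
(seat bsd-cm-prr-ty1 g34, p801395): its §1 `integralComparisonShape_of_katoExpDatum` and §3 `…_of_le` / `…_of_leAt` take the five
structural / analytic conjuncts (tf) (rk) (hχ) (hL) (r5′) as BINDERS; the junction `K2C10FactsJunction_g74.lean` (this crux directory,
commit 38201429e205) discharges those five at every pinned frame from GZK, `X12.ClassCSeven W`, the topological generator, Hecke 1920,
Rohrlich 1988 and one newform of `W`.  This file is the composition, i.e. what is LEFT of K2ᶜ at a frame once print is paid: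
a datum `D : KatoExpDatum hγ Φ` and EITHER a gauge `(t′, m₀)` with the divisibility (KI) `π^{m₀+2jα} ∣ cZ·t′` OR a unit `Φ.t` with the
integer inequality `jα ≤ 2e + 2k + a` ((F-b) letter; `FbPreregistration-g65.md`).

WHAT THIS SHOWS (numbers, not adjectives).  With the three print facts `hecke1920_depletedHeckeL_entire`,
`Rohrlich1988_nonvanishing_twists_anyLevel`, `ModularForms.exists_isNewformOf` as hypotheses, zp v12's `stub_integralComparisonSeven`
letter (the conclusion of (KI)-R ★ / ★″, VERBATIM) follows from the REDUCED input form (3 existentials `Φ, D, (t′, m₀)` + 2 conjuncts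
(ht′) (KI); `integralComparisonSeven_of_reduced`) and from the REDUCED PERIOD-POSITION input form (2 existentials `Φ, D` + 2 atomic
conjuncts `IsUnit Φ.t`, `D.jα ≤ 2 * D.e + 2 * Φ.k + Φ.a`; `integralComparisonSeven_of_reducedPP`) — versus 3 existentials + 7 conjuncts in
the FULL input form ★ consumes and 3 existentials + 8 conjuncts in ★″'s.  No stub closes: the reduced forms are DISPLAYED as hypotheses,
not inhabited; whether zp v17 keeps stub 2 FULL or restates it REDUCED / REDUCED-PP is the pen's call (booking (B2); price of the reduced
letters inside zp = +2 `stub_printFactsKato` conjuncts, Hecke 1920 and Rohrlich 1988, D922).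

HONEST LABEL.  CONDITIONAL glue; every hypothesis displayed; 0 `def` / `instance` / `axiom` / `sorry`; nothing is asserted about any
frame or datum; stmt-BirchSwinnertonDyer-19945 is OPEN (zp v16 `Lines/kato_perrin_riou_zp.lean` bb91f352028468bc, 4 sorries, untouched);
K2ᶜ-inhabitation is NOT done; PR^× (`stub_perrinRiouRatioSeven`) and hR3c are NOT proved; `X12.CMRamifiedSeven` is NOT proved; no summit
statement is proved by this seat; BSD is claimed for no curve.

## Contents
§1 per frame: `integralComparisonShape_of_facts` (gauge + (KI)), `integralComparisonShape_of_facts_of_le` (unit `Φ.t` + `jα ≤ 2e+2k+a`,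
the gauge pair SUPPLIED: `t′ := Φ.t⁻¹`, `m₀ := 0`), `integralComparisonShape_of_facts_of_leAt` (gauge + factorisation `t′ = w′·π^{m′}` +
`m₀ + jα ≤ 2e+2k+a+m′`), the first two also `_of_mod` (newform from `exists_isNewformOf`); §2 global: `integralComparisonSeven_of_reduced`
(= (KI)-R ★ ∘ junction §3, proved here per frame so that the file is SELF-CONTAINED over the tree — it does not import the junction
crux module; the five discharges are called by name), `k2cPinned_of_reduced`, `integralComparisonSeven_of_reducedPP`, `k2cPinned_of_reducedPP`.
Stub-2 line references (critic n8): zp v16 `stub_integralComparisonInputsSeven` = decl l.544, type l.545–564, `sorry` l.565.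

References: K. Kato, Astérisque 295 (2004) §15.16 (15.16.1) (p. 265), 15.14 (p. 264), Prop. 15.9 (p. 258), Thm. 12.4 (2) / 12.5 (1)
(p. 221), 13.5 (p. 227) [Kato2004Asterisque]; E. Hecke, Math. Z. 6 (1920) [Hecke1920]; D. Rohrlich, Invent. Math. 75 (1984) 409–423 /
Math. Ann. (1988) [RohrlichInventiones1984]; C. Breuil, B. Conrad, F. Diamond, R. Taylor, JAMS 14 (2001) Thm. A
[BreuilConradDiamondTaylor2001]; tree: (C6-R) 2/4 p800949, 3/4 p801375, 4/4 p801395 (g34); (T) p783797, (S) p782381, (An) p784707 /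
p789122; junction commit 38201429e205; memo `K2C10RowClosure-g74.md` 80ca36d2c2ad.
-/

noncomputable section

open scoped NumberField
open Field IsDedekindDomain NumberField
open Literature.NumberTheory.GaloisRepresentations
open Literature.NumberTheory.EllipticCurves
open Literature.NumberTheory.EllipticCurves.Rank1Residual
open Literature.NumberTheory.EllipticCurves.IwasawaAlgebra
open Literature.NumberTheory.EllipticCurves.Kato2004
open Literature.NumberTheory.EllipticCurves.ModularForms
open Literature.NumberTheory.ComplexMultiplication.EllipticUnits
open Literature.NumberTheory.LFunctions
open Summit.BirchSwinnertonDyer.Rank1Residual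
open Summit.BirchSwinnertonDyer.Rank1Residual.Additive
open Summit.BirchSwinnertonDyer.Rank1Residual.Additive.GenusSeven

namespace Summit.BirchSwinnertonDyer.BirchSwinnertonDyer.Cruxes.EllipticUnitValueSevenOfGZK.K2C10IntegralComparisonOfFacts

/-! ## §1 `IntegralComparisonShape Φ` at ONE pinned frame from {datum, gauge / period position} + print facts -/

section Frame

variable {W : WeierstrassCurve ℚ} [W.IsElliptic] [W.IsGloballyMinimal] [Fact (Nat.Prime 7)]
  [ContinuousSMul ℤ_[7] (W.tateModule 7)] {K : ZpExtension ℚ 7} {hK : K.IsCyclotomic}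
  {γ : Field.absoluteGaloisGroup ℚ} {I : IwasawaH1Data W 7 K γ}
  {F : GenusFrame} {θu : ∀ n : ℕ, globalUnitsOf (F.layer n)} {d : GenusDatum F θu}

/-- **(B1) `IntegralComparisonShape Φ` from a datum, a gauge and (KI), print paid**: (KI)-R §1
`integralComparisonShape_of_katoExpDatum` with its five structural / analytic binders discharged by the landed per-frame theorems
`tf_of_inputs` / `rk_of_inputs` (T, p783797), `hχ_of_inputs` (S, p782381), `hL_of_inputs` (An, p784707), `r5'_of_facts` (p789122) —
the term of junction §1 `structuralInputs_of_facts`, spelled out so that this file does not import the junction crux module.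
CONDITIONAL; nothing asserted; 19945 OPEN.
[cite: Kato2004Asterisque, (15.16.1) (p. 265), 15.14 (p. 264), Thm. 12.4 (2) (p. 221), 13.5 (p. 227)] [cite: RohrlichInventiones1984, Theorem (p. 409)] -/
theorem integralComparisonShape_of_facts (hGZK : rank_eq_analyticRank_of_analyticRank_le_one) (hC : X12.ClassCSeven W)
    (hγ : K.IsTopGenerator γ) (hHecke : hecke1920_depletedHeckeL_entire)
    (hRo : Rohrlich1988_nonvanishing_twists_anyLevel) {N : ℕ} [NeZero N]
    {f : CuspForm (CongruenceSubgroup.Gamma0 N) 2} (hf : IsNewformOf W f)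
    (Φ : PinnedKatoGenusFrame W K hK I d) (D : KatoExpDatum hγ Φ) (t' : Φ.R) (m₀ : ℕ)
    (ht : Φ.t * t' = Φ.π ^ m₀) (hKI : Φ.π ^ (m₀ + 2 * D.jα) ∣ D.cZ * t') :
    IntegralComparisonShape Φ :=
  integralComparisonShape_of_katoExpDatum hγ Φ D t' m₀ ht (Φ.tf_of_inputs hγ) (Φ.rk_of_inputs hGZK hC hγ)
    Φ.hχ_of_inputs (Φ.hL_of_inputs hHecke) (Φ.r5'_of_facts hRo hC hf) hKI

/-- The same with the newform taken from the tree's modularity fact `exists_isNewformOf`.  CONDITIONAL; 19945 OPEN.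
[cite: BreuilConradDiamondTaylor2001, Thm. A] [cite: Kato2004Asterisque, (15.16.1) (p. 265)] -/
theorem integralComparisonShape_of_mod (hGZK : rank_eq_analyticRank_of_analyticRank_le_one) (hC : X12.ClassCSeven W)
    (hγ : K.IsTopGenerator γ) (hHecke : hecke1920_depletedHeckeL_entire)
    (hRo : Rohrlich1988_nonvanishing_twists_anyLevel) (hmod : ModularForms.exists_isNewformOf)
    (Φ : PinnedKatoGenusFrame W K hK I d) (D : KatoExpDatum hγ Φ) (t' : Φ.R) (m₀ : ℕ)
    (ht : Φ.t * t' = Φ.π ^ m₀) (hKI : Φ.π ^ (m₀ + 2 * D.jα) ∣ D.cZ * t') :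
    IntegralComparisonShape Φ := by
  haveI : NeZero (W.conductorNorm ℤ) := ⟨(W.conductorNorm_pos_holds).ne'⟩
  obtain ⟨f, hf⟩ := hmod W
  exact integralComparisonShape_of_facts hGZK hC hγ hHecke hRo hf Φ D t' m₀ ht hKI

/-- **(B1, (F-b) letter) `IntegralComparisonShape Φ` from a datum, a UNIT `Φ.t` and the integer inequality `jα ≤ 2e + 2k + a`,
print paid**: (KI)-R §3 `integralComparisonShape_of_katoExpDatum_of_le` with the five binders discharged AND the gauge pair supplied
(`t′ := ↑(htu.unit⁻¹)`, `m₀ := 0`, so `Φ.t * t′ = 1 = π^0`) — at a unit `t` the gauge carries no information.  CONDITIONAL; 19945 OPEN.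
[cite: Kato2004Asterisque, (15.16.1) (p. 265), 15.14 (p. 264), Thm. 12.4 (2) (p. 221)] -/
theorem integralComparisonShape_of_facts_of_le (hGZK : rank_eq_analyticRank_of_analyticRank_le_one) (hC : X12.ClassCSeven W)
    (hγ : K.IsTopGenerator γ) (hHecke : hecke1920_depletedHeckeL_entire)
    (hRo : Rohrlich1988_nonvanishing_twists_anyLevel) {N : ℕ} [NeZero N]
    {f : CuspForm (CongruenceSubgroup.Gamma0 N) 2} (hf : IsNewformOf W f)
    (Φ : PinnedKatoGenusFrame W K hK I d) (htu : IsUnit Φ.t) (D : KatoExpDatum hγ Φ)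
    (hPP : D.jα ≤ 2 * D.e + 2 * Φ.k + Φ.a) :
    IntegralComparisonShape Φ :=
  integralComparisonShape_of_katoExpDatum_of_le hγ Φ D (↑(htu.unit⁻¹) : Φ.R) 0
    (by rw [pow_zero]; exact htu.mul_val_inv) (Φ.tf_of_inputs hγ) (Φ.rk_of_inputs hGZK hC hγ)
    Φ.hχ_of_inputs (Φ.hL_of_inputs hHecke) (Φ.r5'_of_facts hRo hC hf) htu hPP

/-- The same with the newform taken from `exists_isNewformOf`.  CONDITIONAL; 19945 OPEN.
[cite: BreuilConradDiamondTaylor2001, Thm. A] [cite: Kato2004Asterisque, (15.16.1) (p. 265)] -/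
theorem integralComparisonShape_of_mod_of_le (hGZK : rank_eq_analyticRank_of_analyticRank_le_one) (hC : X12.ClassCSeven W)
    (hγ : K.IsTopGenerator γ) (hHecke : hecke1920_depletedHeckeL_entire)
    (hRo : Rohrlich1988_nonvanishing_twists_anyLevel) (hmod : ModularForms.exists_isNewformOf)
    (Φ : PinnedKatoGenusFrame W K hK I d) (htu : IsUnit Φ.t) (D : KatoExpDatum hγ Φ)
    (hPP : D.jα ≤ 2 * D.e + 2 * Φ.k + Φ.a) :
    IntegralComparisonShape Φ := by
  haveI : NeZero (W.conductorNorm ℤ) := ⟨(W.conductorNorm_pos_holds).ne'⟩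
  obtain ⟨f, hf⟩ := hmod W
  exact integralComparisonShape_of_facts_of_le hGZK hC hγ hHecke hRo hf Φ htu D hPP

/-- **General gauge, (F-b) letter**: a factorisation `t′ = w′·π^{m′}` and `m₀ + jα ≤ 2e + 2k + a + m′` in place of (KI), print paid
((KI)-R §3 `integralComparisonShape_of_katoExpDatum_of_leAt`).  CONDITIONAL; 19945 OPEN.
[cite: Kato2004Asterisque, (15.16.1) (p. 265), 15.14 (p. 264)] -/
theorem integralComparisonShape_of_facts_of_leAt (hGZK : rank_eq_analyticRank_of_analyticRank_le_one) (hC : X12.ClassCSeven W)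
    (hγ : K.IsTopGenerator γ) (hHecke : hecke1920_depletedHeckeL_entire)
    (hRo : Rohrlich1988_nonvanishing_twists_anyLevel) {N : ℕ} [NeZero N]
    {f : CuspForm (CongruenceSubgroup.Gamma0 N) 2} (hf : IsNewformOf W f)
    (Φ : PinnedKatoGenusFrame W K hK I d) (D : KatoExpDatum hγ Φ) (t' : Φ.R) (m₀ : ℕ)
    (ht : Φ.t * t' = Φ.π ^ m₀) (w' : Φ.R) (m' : ℕ) (ht' : t' = w' * Φ.π ^ m')
    (hPP : m₀ + D.jα ≤ 2 * D.e + 2 * Φ.k + Φ.a + m') :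
    IntegralComparisonShape Φ :=
  integralComparisonShape_of_katoExpDatum_of_leAt hγ Φ D t' m₀ ht (Φ.tf_of_inputs hγ) (Φ.rk_of_inputs hGZK hC hγ)
    Φ.hχ_of_inputs (Φ.hL_of_inputs hHecke) (Φ.r5'_of_facts hRo hC hf) w' m' ht' hPP

end Frame

/-! ## §2 GLOBAL: zp v12's `stub_integralComparisonSeven` letter from the REDUCED input forms + print facts -/

/-- **REDUCED input form + print ⇒ the pinned integral comparison** (zp v12's `stub_integralComparisonSeven` letter = the conclusion
of (KI)-R ★ `integralComparisonSeven_of_katoExpInputs`, VERBATIM).  Per frame: `integralComparisonShape_of_facts`; equivalently ★ applied to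
junction §3 `inputsSevenR_of_reduced` (letters certified equal by the critic, V#22de (c)).  CONDITIONAL; nothing asserted; no stub closes; 19945 OPEN.
[cite: Kato2004Asterisque, §15.16 (15.16.1) (p. 265), 15.14 (p. 264), Prop. 15.9 (p. 258), Thm. 12.4 (2) (p. 221), 13.5 (p. 227)] -/
theorem integralComparisonSeven_of_reduced (hHecke : hecke1920_depletedHeckeL_entire)
    (hRo : Rohrlich1988_nonvanishing_twists_anyLevel) (hmod : ModularForms.exists_isNewformOf)
    (h : Kato2004.exists_zetaClassPosition_of_rank_le_one → rank_eq_analyticRank_of_analyticRank_le_one →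
      ∀ (W : WeierstrassCurve ℚ) [W.IsElliptic] [W.IsGloballyMinimal] [Fact (Nat.Prime 7)], X12.ClassCSeven W →
      letI : ContinuousSMul ℤ_[7] (W.tateModule 7) := TateModule.continuousSMul_padicInt
      ∀ (K : ZpExtension ℚ 7) (hK : K.IsCyclotomic) (γ : Field.absoluteGaloisGroup ℚ) (hγ : K.IsTopGenerator γ)
        (I : IwasawaH1Data W 7 K γ),
        ∃ (F : GenusSeven.GenusFrame) (θu : ∀ n : ℕ, globalUnitsOf (F.layer n)), GenusSeven.IsNormedEllipticUnitFamily F θu ∧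
          ∀ d : GenusSeven.GenusDatum F θu, ∃ Φ : GenusSeven.PinnedKatoGenusFrame W K hK I d, ∃ D : GenusSeven.KatoExpDatum hγ Φ,
            ∃ (t' : Φ.R) (m₀ : ℕ), Φ.t * t' = Φ.π ^ m₀ ∧ Φ.π ^ (m₀ + 2 * D.jα) ∣ D.cZ * t') :
    Kato2004.exists_zetaClassPosition_of_rank_le_one → rank_eq_analyticRank_of_analyticRank_le_one →
    ∀ (W : WeierstrassCurve ℚ) [W.IsElliptic] [W.IsGloballyMinimal] [Fact (Nat.Prime 7)], X12.ClassCSeven W →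
      letI : ContinuousSMul ℤ_[7] (W.tateModule 7) := TateModule.continuousSMul_padicInt
      ∀ (K : ZpExtension ℚ 7) (hK : K.IsCyclotomic) (γ : Field.absoluteGaloisGroup ℚ) (_ : K.IsTopGenerator γ)
        (I : IwasawaH1Data W 7 K γ),
        ∃ (F : GenusSeven.GenusFrame) (θu : ∀ n : ℕ, globalUnitsOf (F.layer n)), GenusSeven.IsNormedEllipticUnitFamily F θu ∧
          ∀ d : GenusSeven.GenusDatum F θu, ∃ Φ : GenusSeven.PinnedKatoGenusFrame W K hK I d,
            GenusSeven.IntegralComparisonShape Φ := by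
  intro hstar hGZK W _ _ _ hC K hK γ hγ I
  haveI : ContinuousSMul ℤ_[7] (W.tateModule 7) := TateModule.continuousSMul_padicInt
  haveI : NeZero (W.conductorNorm ℤ) := ⟨(W.conductorNorm_pos_holds).ne'⟩
  obtain ⟨f, hf⟩ := hmod W
  obtain ⟨F, θu, hpin, hΦ⟩ := h hstar hGZK W hC K hK γ hγ I
  refine ⟨F, θu, hpin, fun d => ?_⟩
  obtain ⟨Φ, D, t', m₀, ht, hKI⟩ := hΦ d
  exact ⟨Φ, integralComparisonShape_of_facts hGZK hC hγ hHecke hRo hf Φ D t' m₀ ht hKI⟩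

/-- **… and «K2cPinned» (v11 letter `ResidueIsGenusUnitClassShape`) from the REDUCED input form + print** ((KI)-R
`k2cPinned_of_katoExpInputs` ∘ junction §3).  CONDITIONAL; nothing asserted; 19945 OPEN. [cite: Kato2004Asterisque, §15.16 (15.16.1) (p. 265)] -/
theorem k2cPinned_of_reduced (hHecke : hecke1920_depletedHeckeL_entire)
    (hRo : Rohrlich1988_nonvanishing_twists_anyLevel) (hmod : ModularForms.exists_isNewformOf)
    (h : Kato2004.exists_zetaClassPosition_of_rank_le_one → rank_eq_analyticRank_of_analyticRank_le_one →
      ∀ (W : WeierstrassCurve ℚ) [W.IsElliptic] [W.IsGloballyMinimal] [Fact (Nat.Prime 7)], X12.ClassCSeven W →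
      letI : ContinuousSMul ℤ_[7] (W.tateModule 7) := TateModule.continuousSMul_padicInt
      ∀ (K : ZpExtension ℚ 7) (hK : K.IsCyclotomic) (γ : Field.absoluteGaloisGroup ℚ) (hγ : K.IsTopGenerator γ)
        (I : IwasawaH1Data W 7 K γ),
        ∃ (F : GenusSeven.GenusFrame) (θu : ∀ n : ℕ, globalUnitsOf (F.layer n)), GenusSeven.IsNormedEllipticUnitFamily F θu ∧
          ∀ d : GenusSeven.GenusDatum F θu, ∃ Φ : GenusSeven.PinnedKatoGenusFrame W K hK I d, ∃ D : GenusSeven.KatoExpDatum hγ Φ,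
            ∃ (t' : Φ.R) (m₀ : ℕ), Φ.t * t' = Φ.π ^ m₀ ∧ Φ.π ^ (m₀ + 2 * D.jα) ∣ D.cZ * t') :
    Kato2004.exists_zetaClassPosition_of_rank_le_one → rank_eq_analyticRank_of_analyticRank_le_one →
    ∀ (W : WeierstrassCurve ℚ) [W.IsElliptic] [W.IsGloballyMinimal] [Fact (Nat.Prime 7)], X12.ClassCSeven W →
      letI : ContinuousSMul ℤ_[7] (W.tateModule 7) := TateModule.continuousSMul_padicInt
      ∀ (K : ZpExtension ℚ 7) (hK : K.IsCyclotomic) (γ : Field.absoluteGaloisGroup ℚ) (_ : K.IsTopGenerator γ)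
        (I : IwasawaH1Data W 7 K γ),
        ∃ (F : GenusSeven.GenusFrame) (θu : ∀ n : ℕ, globalUnitsOf (F.layer n)), GenusSeven.IsNormedEllipticUnitFamily F θu ∧
          ∀ d : GenusSeven.GenusDatum F θu, ∃ Φ : GenusSeven.PinnedKatoGenusFrame W K hK I d,
            GenusSeven.ResidueIsGenusUnitClassShape Φ.toKatoGenusFrame :=
  GenusSeven.k2cPinned_of_integralComparison (integralComparisonSeven_of_reduced hHecke hRo hmod h)

/-- **REDUCED PERIOD-POSITION input form + print ⇒ the pinned integral comparison**: per `W ∈ 𝒞₇` and cyclotomic datum, a normed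
`(F, θu)` such that every genus datum carries a pinned frame `Φ` with a UNIT `Φ.t` and a datum `D : KatoExpDatum hγ Φ` at period
position `jα ≤ 2e + 2k + a` — TWO existentials and TWO atomic conjuncts per frame (★″'s input form has 3 + 8).  Per frame:
`integralComparisonShape_of_facts_of_le`.  CONDITIONAL; nothing asserted; no stub closes; 19945 OPEN.
[cite: Kato2004Asterisque, §15.16 (15.16.1) (p. 265), 15.14 (p. 264), Prop. 15.9 (p. 258), Thm. 12.4 (2) (p. 221), 13.5 (p. 227)] -/
theorem integralComparisonSeven_of_reducedPP (hHecke : hecke1920_depletedHeckeL_entire)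
    (hRo : Rohrlich1988_nonvanishing_twists_anyLevel) (hmod : ModularForms.exists_isNewformOf)
    (h : Kato2004.exists_zetaClassPosition_of_rank_le_one → rank_eq_analyticRank_of_analyticRank_le_one →
      ∀ (W : WeierstrassCurve ℚ) [W.IsElliptic] [W.IsGloballyMinimal] [Fact (Nat.Prime 7)], X12.ClassCSeven W →
      letI : ContinuousSMul ℤ_[7] (W.tateModule 7) := TateModule.continuousSMul_padicInt
      ∀ (K : ZpExtension ℚ 7) (hK : K.IsCyclotomic) (γ : Field.absoluteGaloisGroup ℚ) (hγ : K.IsTopGenerator γ)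
        (I : IwasawaH1Data W 7 K γ),
        ∃ (F : GenusSeven.GenusFrame) (θu : ∀ n : ℕ, globalUnitsOf (F.layer n)), GenusSeven.IsNormedEllipticUnitFamily F θu ∧
          ∀ d : GenusSeven.GenusDatum F θu, ∃ Φ : GenusSeven.PinnedKatoGenusFrame W K hK I d, ∃ D : GenusSeven.KatoExpDatum hγ Φ,
            IsUnit Φ.t ∧ D.jα ≤ 2 * D.e + 2 * Φ.k + Φ.a) :
    Kato2004.exists_zetaClassPosition_of_rank_le_one → rank_eq_analyticRank_of_analyticRank_le_one →
    ∀ (W : WeierstrassCurve ℚ) [W.IsElliptic] [W.IsGloballyMinimal] [Fact (Nat.Prime 7)], X12.ClassCSeven W →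
      letI : ContinuousSMul ℤ_[7] (W.tateModule 7) := TateModule.continuousSMul_padicInt
      ∀ (K : ZpExtension ℚ 7) (hK : K.IsCyclotomic) (γ : Field.absoluteGaloisGroup ℚ) (_ : K.IsTopGenerator γ)
        (I : IwasawaH1Data W 7 K γ),
        ∃ (F : GenusSeven.GenusFrame) (θu : ∀ n : ℕ, globalUnitsOf (F.layer n)), GenusSeven.IsNormedEllipticUnitFamily F θu ∧
          ∀ d : GenusSeven.GenusDatum F θu, ∃ Φ : GenusSeven.PinnedKatoGenusFrame W K hK I d,
            GenusSeven.IntegralComparisonShape Φ := by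
  intro hstar hGZK W _ _ _ hC K hK γ hγ I
  haveI : ContinuousSMul ℤ_[7] (W.tateModule 7) := TateModule.continuousSMul_padicInt
  haveI : NeZero (W.conductorNorm ℤ) := ⟨(W.conductorNorm_pos_holds).ne'⟩
  obtain ⟨f, hf⟩ := hmod W
  obtain ⟨F, θu, hpin, hΦ⟩ := h hstar hGZK W hC K hK γ hγ I
  refine ⟨F, θu, hpin, fun d => ?_⟩
  obtain ⟨Φ, D, htu, hPP⟩ := hΦ d
  exact ⟨Φ, integralComparisonShape_of_facts_of_le hGZK hC hγ hHecke hRo hf Φ htu D hPP⟩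

/-- **… and «K2cPinned» from the REDUCED PERIOD-POSITION input form + print** ((P3) `k2cPinned_of_integralComparison`).
CONDITIONAL; nothing asserted; 19945 OPEN. [cite: Kato2004Asterisque, §15.16 (15.16.1) (p. 265)] -/
theorem k2cPinned_of_reducedPP (hHecke : hecke1920_depletedHeckeL_entire)
    (hRo : Rohrlich1988_nonvanishing_twists_anyLevel) (hmod : ModularForms.exists_isNewformOf)
    (h : Kato2004.exists_zetaClassPosition_of_rank_le_one → rank_eq_analyticRank_of_analyticRank_le_one →
      ∀ (W : WeierstrassCurve ℚ) [W.IsElliptic] [W.IsGloballyMinimal] [Fact (Nat.Prime 7)], X12.ClassCSeven W →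
      letI : ContinuousSMul ℤ_[7] (W.tateModule 7) := TateModule.continuousSMul_padicInt
      ∀ (K : ZpExtension ℚ 7) (hK : K.IsCyclotomic) (γ : Field.absoluteGaloisGroup ℚ) (hγ : K.IsTopGenerator γ)
        (I : IwasawaH1Data W 7 K γ),
        ∃ (F : GenusSeven.GenusFrame) (θu : ∀ n : ℕ, globalUnitsOf (F.layer n)), GenusSeven.IsNormedEllipticUnitFamily F θu ∧
          ∀ d : GenusSeven.GenusDatum F θu, ∃ Φ : GenusSeven.PinnedKatoGenusFrame W K hK I d, ∃ D : GenusSeven.KatoExpDatum hγ Φ,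
            IsUnit Φ.t ∧ D.jα ≤ 2 * D.e + 2 * Φ.k + Φ.a) :
    Kato2004.exists_zetaClassPosition_of_rank_le_one → rank_eq_analyticRank_of_analyticRank_le_one →
    ∀ (W : WeierstrassCurve ℚ) [W.IsElliptic] [W.IsGloballyMinimal] [Fact (Nat.Prime 7)], X12.ClassCSeven W →
      letI : ContinuousSMul ℤ_[7] (W.tateModule 7) := TateModule.continuousSMul_padicInt
      ∀ (K : ZpExtension ℚ 7) (hK : K.IsCyclotomic) (γ : Field.absoluteGaloisGroup ℚ) (_ : K.IsTopGenerator γ)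
        (I : IwasawaH1Data W 7 K γ),
        ∃ (F : GenusSeven.GenusFrame) (θu : ∀ n : ℕ, globalUnitsOf (F.layer n)), GenusSeven.IsNormedEllipticUnitFamily F θu ∧
          ∀ d : GenusSeven.GenusDatum F θu, ∃ Φ : GenusSeven.PinnedKatoGenusFrame W K hK I d,
            GenusSeven.ResidueIsGenusUnitClassShape Φ.toKatoGenusFrame :=
  GenusSeven.k2cPinned_of_integralComparison (integralComparisonSeven_of_reducedPP hHecke hRo hmod h)

end Summit.BirchSwinnertonDyer.BirchSwinnertonDyer.Cruxes.EllipticUnitValueSevenOfGZK.K2C10IntegralComparisonOfFacts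

end
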